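import Literature.MathematicalPhysics.QuantumFieldTheory.Balaban1983to89.B8Eq1119LambdaAnalytic

/-!
# `Balaban1983to89.B8Eq1115LambdaSpace` — T. Bałaban, *Spaces of regular gauge field configurations on a lattice and gauge fixing
# conditions*, Commun. Math. Phys. **99** (1985) 75–102 [Balaban1985RegularSpaces], Sect. E pp. 95–96: the decomposition (1.115)
# «`Q′(λ′) = Q′λ′ + C′(λ′)`» ((213) of [3]) AS AN IDENTITY OF MAPS FROM THE BANACH λ-SPACE OF (1.119) INTO THE `X`-SPACE, with the
# linear averaging `Q′` a BOUNDED OPERATOR of norm `≤ 1`, the nonlinear averaging `Q′(u₁, ·)` ANALYTIC on the ball `‖μ‖ < α₄` ([3] (208),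
# Banach form), and (1.114) «`Q′(λ − H′D′(λ)) = Q′λ`» as an identity in the `X`-space — CONCRETE lattice objects (file 6 of the p05 gen-6
# series; knits unit r05's `B8Eq1119LambdaSpace` with this unit's `B8Eq1113Concrete`/`B8Eq1119LambdaAnalytic`)

statement-level skeleton of published theorems with citation tags; proofs where landed; nothing here is a claim about the Yang–Mills mass gap

PDF held: `paper:balaban1985-cmp99-regular-spaces-gauge-fixing` (journal page = PDF page + 74); p. 96 [PDF 22] (text layer `p0022.txt`,
this unit, 2026-08-21): «Using the equality (213) [3] the above equation can be written in the following form: Q′λ − Q′H′D′(λ) +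
C′(λ − H′D′(λ)) = Q′λ, (1.115)»; p. 95 (1.114) «Q′(λ − H′D′(λ)) = Q′λ»; [3] = [Balaban1985Averaging] p. 50: (208) «Q′_j(u₁,λ) =
(1/i) log ũ′ʲ, j ≤ k, are analytic functions of λ», (212)–(213) «Q′_j(u₁, λ, y) = (Q′_jλ)(y) + C′_j(u₁, λ, y)» with the linear operator
«(Q′_jλ)(y) = Σ_{x∈Bʲ(y)} L^{−jd} R(U₀(Γ^{(j)}_{y,x}))λ(x)» (212).

CITATION HEADER (lean-in-tree rule).  Cell `lit-balaban` (HOME `run/shared/lean/pub/lit-balaban/`), unit `lit-balaban-p05` (Phase-2 proof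
seat p05, gen 6; TAKING line HOME/STATUS.md 2026-08-21T09:39:21Z and its sequel; free-target protocol G.5-34(d); owner of block B8 =
`lit-balaban-r05`, referee ref-4).  Rows served: **`B8.Eq1.113`** ((1.113)–(1.118); the operator reading of (1.114)/(1.115)) and
**`B7.Eq207`**/(208), **`B7.Eq212`** ((212)–(213)) of [3] on the λ-space of unit r05's `B8Eq1119LambdaSpace` (`lamSub U₀ (Lᵏ)`, norm
`max{|λ|, Lᵏ|D_{U₀}λ|}`).

WHAT THIS FILE PROVES (kernel, no `sorry`, standard axioms; one definition with body — the operator `Q′` — the rest theorems; standing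
hypotheses = those of `B8Eq1119LambdaSpace` §3 / p05's `B8Eq1117Concrete.eq1117_existsUnique`):
* §1 `norm_Qprime_le`, `norm_QprimeIter_le`, `bgT_mem_U1`, `norm_QprimeIter_bgT_le` — **the sup-norm bound of the
  linear averaging**: with transporters in `{|u| ≤ 1, |u⁻¹| ≤ 1}` (the averaged backgrounds `Ū₀ʲ`, `j ≤ k`, are `G`-valued under (52),
  `B7Prop2Explicit.avgIter_mem`) and the normalised weights `L⁻ᵈ`, `‖(Q′_jλ)(y)‖ ≤ sup_x ‖λ(x)‖` for all `j ≤ k`.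
* §2 **`QlinL`** — (212) «the linear operator `Q′_j`» as a CONTINUOUS LINEAR MAP `lamSub U₀ (Lᵏ) →L[ℂ] XSpace d k 𝔸`,
  `s ↦ ((Q′_jλ_s)(z))_{j ≤ k, z}`; `QlinL_apply`; **`norm_QlinL_le`**: `‖Q′‖ ≤ 1`.
* §3 **`QlinL_add_Cc_apply`** — (213)/(1.115) on the ball `‖μ‖ < α₄`: `(Q′μ + C′(μ))(j, z) = Q′_j(u₁, λ_μ)(z) = (1/i)·i·log ũ′ʲ(z)`
  (`B8Eq178Averages.Qnl`), i.e. the packaged `Q′ + C′` IS the nonlinear averaging `Q′(u₁, ·)` in the `X`-space.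
* §4 **`analyticOnNhd_Qnl_lamSub`** — [3] (208) IN BANACH FORM: `μ ↦ Q′(u₁, λ_μ) = Q′μ + C′(μ)`, `lamSub U₀ (Lᵏ) ⊃ {‖μ‖ < α₄} → XSpace d k 𝔸`,
  is analytic (`QlinL` continuous linear + `B8Eq1119LambdaAnalytic.analyticOnNhd_Cc`).
* §5 **`eq1114_lamSub`** — (1.114) «`Q′(λ − H′D′(λ)) = Q′λ`» AS AN IDENTITY IN THE `X`-SPACE for every `s` in the set (1.119) (`‖s‖ < ½α₄`),
  `H′c` = r05's bounded `Hc`, `D′` = p05's concrete `B8Eq1113Concrete.Dprime`, given the left-inverse relation `Q′H′ = I` of p. 96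
  (hypothesis `hQH`, as in `B8Eq1113Concrete.eq1114_Dprime`); `norm_linArg_lt` — `‖s − H′cD′(λ_s)‖ < α₄` ((1.119) ⇒ (1.120)).
READINGS: as in the series (one-level weight `w = Lᵏ`, `𝔤ᶜ`-values, `H′` abstract with the (1.92)/(1.120)-type modulus bounds, `C′₂ := 2·C2p d`
in the smallness, GAPS G-B8-17).  NOT CLAIMED: the lattice `H′` and the relation `Q′H′ = I` for it (row B8.Eq1.91 / I-B8-2; here a hypothesis).
REUSED BY NAME: `B7Eq78Linearization.Qprime, QprimeIter, QprimeIter_succ, QprimeIter_add, QprimeIter_smul, conjR, zdBlocking,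
zdBlocking_normalised`, `B8Eq119TwistedAxial.bgT`, `B7Prop2Explicit.avgIter_mem`, `B7Prop1Explicit.axialFn_mem, mem_U1`,
`B8Eq1119LambdaSpace.lamSub, lamOf, lamOf_add, lamOf_smul, lamOf_sub, norm_lamOf_le, Cc, Cc_apply, Hc, lamOf_Hc, norm_Hc_le,
sitewise_of_norm_lt` (r05), `B8Eq1119LambdaAnalytic.analyticOnNhd_Cc`, `B8Eq1113Concrete.Dprime, Dprime_spec, eq1114_Dprime`,
`B8Eq1123Concrete.Cnl`, `B8Eq178Averages.Qnl` (r05), `B8Ineq132.norm_conjR_le` (‖R(u)X‖ ≤ ‖X‖ for u ∈ U1).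
Unit `lit-balaban-p05` (gen 6), 2026-08-21.  Nothing here is new mathematics.

[cite: Balaban1985RegularSpaces, (1.113)–(1.115) pp.95–96, (1.119)–(1.120) p.96; Balaban1985Averaging, (208), (212)–(213) p.50]
-/

noncomputable section

open NormedSpace Finset Metric Set Filter
open scoped BoundedContinuousFunction Topology NNReal

namespace Literature.MathematicalPhysics.QuantumFieldTheory.Balaban1983to89.B8Eq1115LambdaSpace

open B7Prop1Explicit B7Prop2Explicit MatrixLog B7Eq167Flat B7Prop9Flat B7Prop10General
open B7Prop10Flat (one_le_C5 C4'_nonneg C5'_nonneg)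
open B7Eq214General (Cgen)
open B7Eq170Flat (cj)
open B7Eq78Linearization (conjR conjR_apply Blocking Qprime Qprime_apply QprimeIter QprimeIter_zero QprimeIter_succ QprimeIter_add
  QprimeIter_smul zdBlocking zdBlocking_normalised)
open B8Eq119TwistedAxial (bgT)
open B8Eq178Averages (Qnl)
open B8Eq1123Concrete (Cnl)
open B8Ineq125Concrete (C2p C2p_nonneg)
open B8Eq1117Concrete (XSpace CnlF)
open B8Eq1113Concrete (Dprime Dprime_spec eq1114_Dprime)
open B8Eq1119LambdaSpace (PSpace PairIdx lamSub lamOf lamOf_add lamOf_smul lamOf_sub norm_lamOf_le Cc Cc_apply Hc lamOf_Hc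
  norm_Hc_le sitewise_of_norm_lt)
open B8Eq1119LambdaAnalytic (analyticOnNhd_Cc)

-- `Site` alone would resolve to the torus sites of `Setup.lean`; re-export the `ℤ^d` sites of `B7Prop1Explicit`.
export B7Prop1Explicit (Site)

variable {d : ℕ}

/-! ## §1 The sup-norm bound of the linear averaging `Q′_j` -/

section SupBound

variable {𝔸 : Type*} [NormedRing 𝔸] [NormOneClass 𝔸] [NormedAlgebra ℂ 𝔸] [CompleteSpace 𝔸]

omit [CompleteSpace 𝔸] in
/-- One step of (212)/(3.19): a normalised average with nonnegative weights of conjugates by transporters in `{|u| ≤ 1, |u⁻¹| ≤ 1}`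
is bounded by the sup of the averaged function on the block. [cite: Balaban1985Averaging, (212) p.50] (elementary; our proof) -/
theorem norm_Qprime_le {ι : Type*} (t : Finset ι) (wt : ι → ℝ) (hwt0 : ∀ x ∈ t, 0 ≤ wt x) (hwt1 : ∑ x ∈ t, wt x = 1)
    (T : ι → 𝔸ˣ) (hT : ∀ x ∈ t, T x ∈ U1 𝔸) {μ : ι → 𝔸} {M : ℝ} (hμ : ∀ x ∈ t, ‖μ x‖ ≤ M) :
    ‖Qprime t wt T μ‖ ≤ M := by
  rw [Qprime_apply]
  calc ‖∑ x ∈ t, wt x • conjR (T x) (μ x)‖ ≤ ∑ x ∈ t, ‖wt x • conjR (T x) (μ x)‖ := norm_sum_le _ _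
    _ ≤ ∑ x ∈ t, wt x * M := Finset.sum_le_sum fun x hx => by
        rw [norm_smul, Real.norm_of_nonneg (hwt0 x hx)]
        exact mul_le_mul_of_nonneg_left ((B8Ineq132.norm_conjR_le (hT x hx) _).trans (hμ x hx)) (hwt0 x hx)
    _ = M := by rw [← Finset.sum_mul, hwt1, one_mul]

omit [CompleteSpace 𝔸] in
/-- **`‖(Q′_jλ)(y)‖ ≤ sup_x ‖λ(x)‖`** for the composite (3.19)/(212) over any normalised blocking with nonnegative weights and
transporters in `{|u| ≤ 1, |u⁻¹| ≤ 1}` at the levels `< n`, for all `j ≤ n` (induction on `j`).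
[cite: Balaban1985Averaging, (212) p.50; Balaban1985BackgroundPropagators, (3.19) p.393] (elementary; our proof) -/
theorem norm_QprimeIter_le {ι : Type*} (G : Blocking ι) (hGn : G.Normalised) (hwt : ∀ j y x, 0 ≤ G.wt j y x)
    (T : ℕ → ι → ι → 𝔸ˣ) {n : ℕ} (hT : ∀ j < n, ∀ y x, T j y x ∈ U1 𝔸) {μ : ι → 𝔸} {M : ℝ} (hμ : ∀ x, ‖μ x‖ ≤ M) :
    ∀ j ≤ n, ∀ y, ‖QprimeIter G T j μ y‖ ≤ M := by
  intro j
  induction j with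
  | zero => intro _ y; simpa using hμ y
  | succ j ih =>
    intro hj y
    rw [QprimeIter_succ]
    exact norm_Qprime_le _ _ (fun x _ => hwt j y x) (hGn j y) _ (fun x _ => hT j (by omega) y x) fun x _ => ih (by omega) x

variable {L : ℕ} {G : Subgroup 𝔸ˣ} {U₀ : Site d → Fin d → 𝔸ˣ} {k : ℕ} {α₀ : ℝ}

/-- Under (52) the background transporters `Ū₀ʲ(Γ_{Ly,x})` of the levels `j ≤ k` lie in `{|u| ≤ 1, |u⁻¹| ≤ 1}` (the averages
`Ū₀ʲ` are `G`-valued, `B7Prop2Explicit.avgIter_mem`; `G ⊂ U1`). [cite: Balaban1985Averaging, (52)–(53) p.26, (78)–(80) p.30] -/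
theorem bgT_mem_U1 (hL : 2 ≤ L) (hG : AvgClosed d L G) (hU : ∀ x κ, U₀ x κ ∈ G)
    (hα : 0 < α₀) (hα3 : C0 d * α₀ ≤ 1 / 3) (hα2 : 2 * α₀ ≤ c2' d L) (h52 : pdev U₀ < α₀ * (((L : ℝ) ^ k)⁻¹) ^ 2) :
    ∀ j ≤ k, ∀ y x : Site d, bgT L U₀ j y x ∈ U1 𝔸 := by
  intro j hj y x
  have hmem : ∀ (x' : Site d) (κ : Fin d), avgIter L U₀ j x' κ ∈ U1 𝔸 := fun x' κ =>
    hG.le_U1 (avgIter_mem L hL hG k U₀ hU hα hα3 hα2 h52 j hj x' κ)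
  exact axialFn_mem hmem _ _

/-- **`‖(Q′_jλ)(y)‖ ≤ sup_x ‖λ(x)‖` for the concrete `Q′_j` at the background `U₀`** (blocks `B(y)`, weights `L⁻ᵈ`, transporters
`Ū₀ʲ(Γ_{Ly,x})`), all `j ≤ k`, under (52). [cite: Balaban1985Averaging, (212) p.50] -/
theorem norm_QprimeIter_bgT_le (hL : 2 ≤ L) (hG : AvgClosed d L G) (hU : ∀ x κ, U₀ x κ ∈ G)
    (hα : 0 < α₀) (hα3 : C0 d * α₀ ≤ 1 / 3) (hα2 : 2 * α₀ ≤ c2' d L) (h52 : pdev U₀ < α₀ * (((L : ℝ) ^ k)⁻¹) ^ 2)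
    {μ : Site d → 𝔸} {M : ℝ} (hμ : ∀ x, ‖μ x‖ ≤ M) :
    ∀ j ≤ k, ∀ y : Site d, ‖QprimeIter (zdBlocking d L) (bgT L U₀) j μ y‖ ≤ M :=
  norm_QprimeIter_le (zdBlocking d L) (zdBlocking_normalised L (by omega))
    (fun _ _ _ => by show (0 : ℝ) ≤ ((L : ℝ) ^ d)⁻¹; positivity) (bgT L U₀) (n := k)
    (fun j hj y x => bgT_mem_U1 hL hG hU hα hα3 hα2 h52 j hj.le y x) hμ

end SupBound

/-! ## §2 (212) «the linear operator `Q′_j`» as a bounded operator on the λ-space -/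

section Operator

variable {𝔸 : Type*} [NormedRing 𝔸] [NormOneClass 𝔸] [NormedAlgebra ℂ 𝔸] [CompleteSpace 𝔸]
variable {L : ℕ} {G : Subgroup 𝔸ˣ} {U₀ : Site d → Fin d → 𝔸ˣ} {k : ℕ} {u₁ : Site d → 𝔸ˣ}
  {α₀ α₃ α₄ B₀' : ℝ} {H' : XSpace d k 𝔸 →ₗ[ℂ] (Site d → 𝔸)}

/-- **(212) «the linear operator `(Q′_jλ)(y) = Σ_{x∈Bʲ(y)} L^{−jd}R(U₀(Γ^{(j)}_{y,x}))λ(x)`» AS A CONTINUOUS LINEAR MAP** from the λ-space of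
(1.119) (`lamSub U₀ (Lᵏ)`, unit r05) into the `X`-space: `s ↦ ((Q′_jλ_s)(z))_{j ≤ k, z}`, bounded by `‖s‖` coordinatewise (§1; under (52) the
transporters are in `{|u| ≤ 1, |u⁻¹| ≤ 1}`), hence of operator norm `≤ 1`. [cite: Balaban1985Averaging, (212) p.50; Balaban1985RegularSpaces, (1.114)–(1.115) pp.95–96] -/
def QlinL (hL : 2 ≤ L) (hG : AvgClosed d L G) (hU : ∀ x κ, U₀ x κ ∈ G)
    (hα : 0 < α₀) (hα3 : C0 d * α₀ ≤ 1 / 3) (hα2 : 2 * α₀ ≤ c2' d L) (h52 : pdev U₀ < α₀ * (((L : ℝ) ^ k)⁻¹) ^ 2) :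
    lamSub U₀ ((L : ℝ) ^ k) →L[ℂ] XSpace d k 𝔸 :=
  LinearMap.mkContinuous
    { toFun := fun s => BoundedContinuousFunction.ofNormedAddCommGroupDiscrete
        (fun p : Fin (k + 1) × Site d => QprimeIter (zdBlocking d L) (bgT L U₀) p.1 (lamOf s) p.2) ‖s‖
        (fun p => norm_QprimeIter_bgT_le hL hG hU hα hα3 hα2 h52 (norm_lamOf_le s) p.1 (Nat.le_of_lt_succ p.1.isLt) p.2)
      map_add' := fun s t => by
        ext p
        simp only [BoundedContinuousFunction.coe_ofNormedAddCommGroupDiscrete, BoundedContinuousFunction.coe_add, Pi.add_apply,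
          lamOf_add, Pi.add_def, QprimeIter_add]
      map_smul' := fun c s => by
        ext p
        simp only [BoundedContinuousFunction.coe_ofNormedAddCommGroupDiscrete, BoundedContinuousFunction.coe_smul,
          RingHom.id_apply, lamOf_smul, Pi.smul_def, QprimeIter_smul] }
    1 fun s => by
      rw [one_mul]
      exact (BoundedContinuousFunction.norm_le (norm_nonneg _)).2 fun p =>
        norm_QprimeIter_bgT_le hL hG hU hα hα3 hα2 h52 (norm_lamOf_le s) p.1 (Nat.le_of_lt_succ p.1.isLt) p.2

/-- `QlinL s (j, z) = (Q′_jλ_s)(z)`. [cite: Balaban1985Averaging, (212) p.50] -/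
theorem QlinL_apply (hL : 2 ≤ L) (hG : AvgClosed d L G) (hU : ∀ x κ, U₀ x κ ∈ G)
    (hα : 0 < α₀) (hα3 : C0 d * α₀ ≤ 1 / 3) (hα2 : 2 * α₀ ≤ c2' d L) (h52 : pdev U₀ < α₀ * (((L : ℝ) ^ k)⁻¹) ^ 2)
    (s : lamSub U₀ ((L : ℝ) ^ k)) (p : Fin (k + 1) × Site d) :
    QlinL hL hG hU hα hα3 hα2 h52 s p = QprimeIter (zdBlocking d L) (bgT L U₀) p.1 (lamOf s) p.2 := rfl

/-- **`‖Q′‖ ≤ 1`** on the λ-space. [cite: Balaban1985Averaging, (212) p.50] -/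
theorem norm_QlinL_le (hL : 2 ≤ L) (hG : AvgClosed d L G) (hU : ∀ x κ, U₀ x κ ∈ G)
    (hα : 0 < α₀) (hα3 : C0 d * α₀ ≤ 1 / 3) (hα2 : 2 * α₀ ≤ c2' d L) (h52 : pdev U₀ < α₀ * (((L : ℝ) ^ k)⁻¹) ^ 2) :
    ‖QlinL hL hG hU hα hα3 hα2 h52‖ ≤ 1 :=
  LinearMap.mkContinuous_norm_le _ zero_le_one _

/-! ## §3–§5 (213) and (208) on the λ-space; (1.114) in the `X`-space -/

variable (hL : 2 ≤ L) (hG : AvgClosed d L G) (hU : ∀ x κ, U₀ x κ ∈ G)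
  (hα : 0 < α₀) (hα3 : C0 d * α₀ ≤ 1 / 3) (hα2 : 2 * α₀ ≤ c2' d L)
  (h52 : pdev U₀ < α₀ * (((L : ℝ) ^ k)⁻¹) ^ 2)
  (hB : 0 < B₀')
  (hH0 : ∀ (X : XSpace d k 𝔸) (x : Site d), ‖H' X x‖ ≤ B₀' * ‖X‖)
  (hH1 : ∀ (X : XSpace d k 𝔸) (x : Site d) (κ : Fin d),
    ‖cj (U₀ x κ) (H' X (x + e κ)) - H' X x‖ ≤ B₀' * ‖X‖ * ((L : ℝ) ^ k)⁻¹)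
  (hu₁ : InLambda L U₀ u₁ k α₃ (((L : ℝ) ^ k)⁻¹))
  (hα₃ : 0 ≤ α₃) (hα₃' : α₃ ≤ 1 / 200) (hα₄ : 0 < α₄)
  (hs₁ : 200 * C6 d * (2 * α₄) ≤ 1) (hs₂ : 12000 * ((d : ℝ) + 1) * L * (2 * α₄) ≤ 1)
  (hs₃ : C4G d L * (α₀ + α₃ + 4 * (2 * α₄)) ≤ 1)
  (hs₄ : 1024 * ((d : ℝ) + 1) * ((d : ℝ) + 4) * L ^ 2 * α₀ ≤ 1) (hs₅ : 32 * ((d : ℝ) + 1) ^ 2 * C6 d * L ^ 2 * α₀ ≤ 1)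
  (hs₆ : 16 * d * C5' d * C6 d * (L : ℝ) ^ 2 * α₀ ≤ 1) (hs₇ : 8 * d * C6 d * L * α₀ ≤ 1)

include hL hG hU hα hα3 hα2 h52 hu₁ hα₃ hα₃' hα₄ hs₁ hs₂ hs₃ hs₄ hs₅ hs₆ hs₇

/-- **(213)/(1.115) on the ball `‖μ‖ < α₄` of the λ-space, in the `X`-space**: the packaged `Q′μ + C′(μ)` has coordinates
`(Q′_jλ_μ)(z) + C′_j(u₁, λ_μ)(z) = Q′_j(u₁, λ_μ)(z)` — the nonlinear averaging `(1/i) log ũ′ʲ(z)` of `u′ = e^{λ_μ}` (`B8Eq178Averages.Qnl`).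
[cite: Balaban1985Averaging, (213) p.50; Balaban1985RegularSpaces, (1.115) p.96] -/
theorem QlinL_add_Cc_apply {μ : lamSub U₀ ((L : ℝ) ^ k)} (hμ : ‖μ‖ < α₄) (p : Fin (k + 1) × Site d) :
    (QlinL hL hG hU hα hα3 hα2 h52 μ + Cc L U₀ u₁ k μ) p = Qnl L U₀ (fun x => expUnit (lamOf μ x)) u₁ p.1 p.2 := by
  rw [BoundedContinuousFunction.coe_add, Pi.add_apply, QlinL_apply,
    Cc_apply hL hG hU hα hα3 hα2 h52 hu₁ hα₃ hα₃' hα₄ hs₁ hs₂ hs₃ hs₄ hs₅ hs₆ hs₇ hμ p, Cnl]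
  abel

/-- **[3] (208) IN BANACH FORM — «Q′_j(u₁,λ) = (1/i) log ũ′ʲ, j ≤ k, are analytic functions of λ»**: the nonlinear averaging
`μ ↦ Q′(u₁, λ_μ) = Q′μ + C′(μ)`, as a map from the ball `‖μ‖ < α₄` of the λ-space `lamSub U₀ (Lᵏ)` into the Banach space `XSpace d k 𝔸`
of all levels `j ≤ k` and sites, is analytic (`Q′` continuous linear, `C′` analytic by `B8Eq1119LambdaAnalytic.analyticOnNhd_Cc`).
[cite: Balaban1985Averaging, (208), (213) p.50] -/
theorem analyticOnNhd_Qnl_lamSub :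
    AnalyticOnNhd ℂ (fun μ : lamSub U₀ ((L : ℝ) ^ k) => QlinL hL hG hU hα hα3 hα2 h52 μ + Cc L U₀ u₁ k μ)
      {μ : lamSub U₀ ((L : ℝ) ^ k) | ‖μ‖ < α₄} :=
  ((QlinL hL hG hU hα hα3 hα2 h52).analyticOnNhd _).add
    (analyticOnNhd_Cc hL hG hU hα hα3 hα2 h52 hu₁ hα₃ hα₃' hα₄ hs₁ hs₂ hs₃ hs₄ hs₅ hs₆ hs₇)

include hB hH0 hH1 in
/-- **(1.119) ⇒ (1.120) on the λ-space**: for `‖s‖ < ½α₄` the argument `s − H′cD′(λ_s)` of (1.114) has norm `< α₄` (`‖H′c‖ ≤ B′₀`,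
`‖D′(λ_s)‖ ≤ α₄/(2B′₀)`). [cite: Balaban1985RegularSpaces, (1.119)–(1.120) p.96] -/
theorem norm_linArg_lt (hsm : α₃ + α₄ ≤ 1 / (4 * B₀' * (2 * C2p d))) {s : lamSub U₀ ((L : ℝ) ^ k)} (hs : ‖s‖ < α₄ / 2) :
    ‖s - Hc U₀ (by positivity : (0 : ℝ) < (L : ℝ) ^ k) H' hB.le hH0 hH1 (Dprime L U₀ u₁ k H' (α₄ / (2 * B₀')) (lamOf s))‖ < α₄ := by
  obtain ⟨ha, hb⟩ := sitewise_of_norm_lt (U₀ := U₀) hL hs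
  have hD : ‖Dprime L U₀ u₁ k H' (α₄ / (2 * B₀')) (lamOf s)‖ ≤ α₄ / (2 * B₀') :=
    (Dprime_spec hL hG hU H' (lamOf s) hα hα3 hα2 h52 hB hH0 hH1 ha hb hu₁ hα₃ hα₃' hs₁ hs₂ hs₃ hs₄ hs₅ hs₆ hs₇ hsm).1.1
  have hHc := norm_Hc_le U₀ (by positivity : (0 : ℝ) < (L : ℝ) ^ k) H' hB.le hH0 hH1
  have hHD : ‖Hc U₀ (by positivity : (0 : ℝ) < (L : ℝ) ^ k) H' hB.le hH0 hH1 (Dprime L U₀ u₁ k H' (α₄ / (2 * B₀')) (lamOf s))‖ ≤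
      α₄ / 2 := by
    calc _ ≤ ‖Hc U₀ (by positivity : (0 : ℝ) < (L : ℝ) ^ k) H' hB.le hH0 hH1‖ *
          ‖Dprime L U₀ u₁ k H' (α₄ / (2 * B₀')) (lamOf s)‖ := ContinuousLinearMap.le_opNorm _ _
      _ ≤ B₀' * (α₄ / (2 * B₀')) := by gcongr
      _ = α₄ / 2 := by field_simp
  calc _ ≤ ‖s‖ + ‖Hc U₀ (by positivity : (0 : ℝ) < (L : ℝ) ^ k) H' hB.le hH0 hH1
          (Dprime L U₀ u₁ k H' (α₄ / (2 * B₀')) (lamOf s))‖ := norm_sub_le _ _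
    _ < α₄ / 2 + α₄ / 2 := add_lt_add_of_lt_of_le hs hHD
    _ = α₄ := by ring

include hB hH0 hH1 in
/-- **(1.114) «`Q′(λ − H′D′(λ)) = Q′λ`» AS AN IDENTITY IN THE `X`-SPACE**, on the λ-space of (1.119): for every `s` with `‖s‖ < ½α₄`,
with `s′ := s − H′cD′(λ_s)` ((1.113); `H′c` = r05's `Hc`, `D′` = p05's concrete `Dprime` of radius `α₄/(2B′₀)`),
`Q′s′ + C′(s′) = Q′s` — i.e. `Q′(u₁, λ − H′D′(λ)) = Q′λ` at all levels `j ≤ k` and sites (p. 96 (1.115)–(1.116)), given the left-inverse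
relation `Q′H′ = I` of p. 96 (hypothesis `hQH`; the lattice `H′` is row B8.Eq1.91).  From p05's sitewise `B8Eq1113Concrete.eq1114_Dprime`.
[cite: Balaban1985RegularSpaces, (1.113)–(1.116) pp.95–96] -/
theorem eq1114_lamSub (hsm : α₃ + α₄ ≤ 1 / (4 * B₀' * (2 * C2p d)))
    (hQH : ∀ (Y : XSpace d k 𝔸) (j : ℕ) (hj : j ≤ k) (z : Site d),
      QprimeIter (zdBlocking d L) (bgT L U₀) j (H' Y) z = Y (⟨j, Nat.lt_succ_of_le hj⟩, z))
    {s : lamSub U₀ ((L : ℝ) ^ k)} (hs : ‖s‖ < α₄ / 2) :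
    QlinL hL hG hU hα hα3 hα2 h52
        (s - Hc U₀ (by positivity : (0 : ℝ) < (L : ℝ) ^ k) H' hB.le hH0 hH1 (Dprime L U₀ u₁ k H' (α₄ / (2 * B₀')) (lamOf s))) +
      Cc L U₀ u₁ k
        (s - Hc U₀ (by positivity : (0 : ℝ) < (L : ℝ) ^ k) H' hB.le hH0 hH1 (Dprime L U₀ u₁ k H' (α₄ / (2 * B₀')) (lamOf s))) =
      QlinL hL hG hU hα hα3 hα2 h52 s := by
  have hlt := norm_linArg_lt hL hG hU hα hα3 hα2 h52 hB hH0 hH1 hu₁ hα₃ hα₃' hα₄ hs₁ hs₂ hs₃ hs₄ hs₅ hs₆ hs₇ hsm hs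
  obtain ⟨ha, hb⟩ := sitewise_of_norm_lt (U₀ := U₀) hL hs
  have h1114 := eq1114_Dprime hL hG hU H' (lamOf s) hα hα3 hα2 h52 hB hH0 hH1 hQH ha hb hu₁ hα₃ hα₃' hs₁ hs₂ hs₃ hs₄ hs₅
    hs₆ hs₇ hsm
  ext p
  rw [QlinL_add_Cc_apply hL hG hU hα hα3 hα2 h52 hu₁ hα₃ hα₃' hα₄ hs₁ hs₂ hs₃ hs₄ hs₅ hs₆ hs₇ hlt p, QlinL_apply, lamOf_sub,
    lamOf_Hc]
  exact h1114 p.1 (Nat.le_of_lt_succ p.1.isLt) p.2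

end Operator

end Literature.MathematicalPhysics.QuantumFieldTheory.Balaban1983to89.B8Eq1115LambdaSpace

end
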